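import Mathlib
import HarnessLib
import Summits.AtomisticToContinuum.FouriersLaw.Theorems.JunctionLocalityConductanceLowerBoundStubShortTimeDipoleFloorAux13
import Summits.AtomisticToContinuum.FouriersLaw.Theorems.JunctionLocalityConductanceLowerBoundStubShortTimeDipoleFloorAux14

/-!
# Short-time dipole floor, helper 15: time continuity of the contact-bond term, uniformly in `N`

Helper (`--supports stmt-AtomisticToContinuum-11749`) for stub `stub_shortTimeDipoleFloor` (S) of line
`kick-dipole-no-collapse`, crux `JunctionLocality.ConductanceLowerBound`.

For the pinned anharmonic chain (both baths at `T`), the stationary law `π = μ_T ⊗ W` and the contact power `a₀ = p_0 ∂_{q_0}H`: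

  `∫⁻ |a₀(x)| · |j_0(Φ_s(x, ω)) − j_0(x)| dπ ≤ B √s`,  `s ∈ [0, 1]`,

with `B` depending only on `(ω₂, lam, β, γ, T)` (`helper_kdContactBondContinuity`).  Pathwise, the one-scalar domination of
`δj_0` (helper 10) reduces it to the displacement of the two contact sites, `|δq_m| + |δp_m| ≤ ∫₀ˢ|p_m| + |η_m(s)| + ∫₀ˢ|Y_{p,m}|`
(the integral equation); the three pieces have second moments `O(s²)`, `O(s)`, `O(s²)` under `π` (helper 14: Jensen + stationarity,
the noise, the `N`-uniform drift moment), the prefactor `c_j |a₀| E_0(x)² E_0(Φ_s x)²` has an `N`-uniform second moment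
(bond-scalar moments of helper 11), and Cauchy–Schwarz concludes.  All tactic work is done in abstract lemmas.
-/

noncomputable section

open MeasureTheory ProbabilityTheory Set Filter Topology Finset
open scoped NNReal ENNReal

namespace Summit.AtomisticToContinuum.FouriersLaw.Cruxes.ConductanceLowerBound.KickDipoleNoCollapse

open Literature.MathematicalPhysics.KineticTheory Literature.MathematicalPhysics.KineticTheory.HeatConduction
open Literature.Probability.Process OscillatorChain
open Summit.AtomisticToContinuum.FouriersLaw.Theorems
open Summit.AtomisticToContinuum.FouriersLaw.Theorems.NonBallistic
open Summit.AtomisticToContinuum.FouriersLaw.Theorems.NonBallistic.LightConePropagation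

/-! ### Abstract cores -/

/-- `x^10 y^4 ≤ x^14 + y^14` for `x, y ≥ 0`. -/
theorem pow_ten_mul_pow_four_le {x y : ℝ} (hx : 0 ≤ x) (hy : 0 ≤ y) : x ^ 10 * y ^ 4 ≤ x ^ 14 + y ^ 14 := by
  rcases le_total x y with h | h
  · calc x ^ 10 * y ^ 4 ≤ y ^ 10 * y ^ 4 := mul_le_mul_of_nonneg_right (pow_le_pow_left₀ hx h 10) (by positivity)
      _ ≤ x ^ 14 + y ^ 14 := by linarith [pow_nonneg hx 14, show y ^ 10 * y ^ 4 = y ^ 14 by ring]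
  · calc x ^ 10 * y ^ 4 ≤ x ^ 10 * x ^ 4 := mul_le_mul_of_nonneg_left (pow_le_pow_left₀ hy h 4) (by positivity)
      _ ≤ x ^ 14 + y ^ 14 := by linarith [pow_nonneg hy 14, show x ^ 10 * x ^ 4 = x ^ 14 by ring]

/-- **The squared near prefactor, abstract core**: if `|a| ≤ c_a E₀³`, `E₀ ≥ 1`, `E ≥ 0` and the fourteenth moments of `E₀, E` are
`≤ K`, then `∫⁻ (c_j |a| E₀² E²)² ≤ 2 c_j² c_a² K`. -/
theorem lintegral_nearPrefactor_sq_le_abstract {Ω : Type*} [MeasurableSpace Ω] (π : Measure Ω) {cj ca K : ℝ}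
    (hcj : 0 ≤ cj) (_hca : 0 ≤ ca) (hK0 : 0 ≤ K) {a E0 Es : Ω → ℝ} (hE0m : Measurable E0) (hEsm : Measurable Es)
    (hE01 : ∀ q, 1 ≤ E0 q) (hEs0 : ∀ q, 0 ≤ Es q) (hap : ∀ q, |a q| ≤ ca * E0 q ^ 3)
    (h0 : ∫⁻ q, ENNReal.ofReal (E0 q ^ 14) ∂π ≤ ENNReal.ofReal K) (hs : ∫⁻ q, ENNReal.ofReal (Es q ^ 14) ∂π ≤ ENNReal.ofReal K) :
    ∫⁻ q, ENNReal.ofReal (cj * |a q| * E0 q ^ 2 * Es q ^ 2) ^ 2 ∂π ≤ ENNReal.ofReal (2 * cj ^ 2 * ca ^ 2 * K) := by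
  have hE00 : ∀ q, 0 ≤ E0 q := fun q => zero_le_one.trans (hE01 q)
  have hpt : ∀ q, ENNReal.ofReal (cj * |a q| * E0 q ^ 2 * Es q ^ 2) ^ 2 ≤
      ENNReal.ofReal (cj ^ 2 * ca ^ 2) * (ENNReal.ofReal (E0 q ^ 14) + ENNReal.ofReal (Es q ^ 14)) := by
    intro q
    have hG0 : 0 ≤ cj * |a q| * E0 q ^ 2 * Es q ^ 2 := by positivity
    have hG : cj * |a q| * E0 q ^ 2 * Es q ^ 2 ≤ cj * ca * (E0 q ^ 5 * Es q ^ 2) := by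
      have h2 : 0 ≤ E0 q ^ 2 * Es q ^ 2 := by positivity
      calc cj * |a q| * E0 q ^ 2 * Es q ^ 2 = cj * |a q| * (E0 q ^ 2 * Es q ^ 2) := by ring
        _ ≤ cj * (ca * E0 q ^ 3) * (E0 q ^ 2 * Es q ^ 2) :=
            mul_le_mul_of_nonneg_right (mul_le_mul_of_nonneg_left (hap q) hcj) h2
        _ = cj * ca * (E0 q ^ 5 * Es q ^ 2) := by ring
    have hreal : (cj * |a q| * E0 q ^ 2 * Es q ^ 2) ^ 2 ≤ cj ^ 2 * ca ^ 2 * (E0 q ^ 14 + Es q ^ 14) :=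
      calc (cj * |a q| * E0 q ^ 2 * Es q ^ 2) ^ 2 ≤ (cj * ca * (E0 q ^ 5 * Es q ^ 2)) ^ 2 := pow_le_pow_left₀ hG0 hG 2
        _ = cj ^ 2 * ca ^ 2 * (E0 q ^ 10 * Es q ^ 4) := by ring
        _ ≤ cj ^ 2 * ca ^ 2 * (E0 q ^ 14 + Es q ^ 14) :=
            mul_le_mul_of_nonneg_left (pow_ten_mul_pow_four_le (hE00 q) (hEs0 q)) (by positivity)
    rw [← ENNReal.ofReal_pow hG0]
    calc ENNReal.ofReal ((cj * |a q| * E0 q ^ 2 * Es q ^ 2) ^ 2)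
        ≤ ENNReal.ofReal (cj ^ 2 * ca ^ 2 * (E0 q ^ 14 + Es q ^ 14)) := ENNReal.ofReal_le_ofReal hreal
      _ = _ := by rw [ENNReal.ofReal_mul (by positivity), ENNReal.ofReal_add (by positivity) (by positivity)]
  have m1 : Measurable fun q => ENNReal.ofReal (E0 q ^ 14) := (hE0m.pow_const 14).ennreal_ofReal
  have m2 : Measurable fun q => ENNReal.ofReal (Es q ^ 14) := (hEsm.pow_const 14).ennreal_ofReal
  have m12 : Measurable fun q => ENNReal.ofReal (E0 q ^ 14) + ENNReal.ofReal (Es q ^ 14) := m1.add m2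
  calc ∫⁻ q, ENNReal.ofReal (cj * |a q| * E0 q ^ 2 * Es q ^ 2) ^ 2 ∂π
      ≤ ∫⁻ q, ENNReal.ofReal (cj ^ 2 * ca ^ 2) * (ENNReal.ofReal (E0 q ^ 14) + ENNReal.ofReal (Es q ^ 14)) ∂π :=
        lintegral_mono hpt
    _ = ENNReal.ofReal (cj ^ 2 * ca ^ 2) * (∫⁻ q, ENNReal.ofReal (E0 q ^ 14) ∂π + ∫⁻ q, ENNReal.ofReal (Es q ^ 14) ∂π) := by
        rw [lintegral_const_mul _ m12, lintegral_add_right _ m2]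
    _ ≤ ENNReal.ofReal (cj ^ 2 * ca ^ 2) * (ENNReal.ofReal K + ENNReal.ofReal K) :=
        mul_le_mul' le_rfl (add_le_add h0 hs)
    _ = ENNReal.ofReal (2 * cj ^ 2 * ca ^ 2 * K) := by
        rw [← ENNReal.ofReal_add hK0 hK0, ← ENNReal.ofReal_mul (by positivity)]
        congr 1; ring

/-- **Second moment of a displacement, abstract core**: `d ≤ I₁ + I₂ + I₃` with `∫⁻ I₁² ≤ a`, `∫⁻ I₂² ≤ b`, `∫⁻ I₃² ≤ c` gives
`∫⁻ d² ≤ 3(a + b + c)`. -/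
theorem lintegral_displacement_sq_le_abstract {Ω : Type*} [MeasurableSpace Ω] (π : Measure Ω) {d I₁ I₂ I₃ : Ω → ℝ}
    {a b c : ℝ} (h1m : Measurable I₁) (h2m : Measurable I₂) (h3m : Measurable I₃) (hd0 : ∀ q, 0 ≤ d q)
    (ha : 0 ≤ a) (hb : 0 ≤ b) (hc : 0 ≤ c) (hle : ∀ q, d q ≤ I₁ q + I₂ q + I₃ q)
    (hI₁ : ∫⁻ q, ENNReal.ofReal (I₁ q ^ 2) ∂π ≤ ENNReal.ofReal a) (hI₂ : ∫⁻ q, ENNReal.ofReal (I₂ q ^ 2) ∂π ≤ ENNReal.ofReal b)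
    (hI₃ : ∫⁻ q, ENNReal.ofReal (I₃ q ^ 2) ∂π ≤ ENNReal.ofReal c) :
    ∫⁻ q, ENNReal.ofReal (d q ^ 2) ∂π ≤ ENNReal.ofReal (3 * (a + b + c)) := by
  have hpt : ∀ q, ENNReal.ofReal (d q ^ 2) ≤
      3 * (ENNReal.ofReal (I₁ q ^ 2) + ENNReal.ofReal (I₂ q ^ 2) + ENNReal.ofReal (I₃ q ^ 2)) := by
    intro q
    have h1 : d q ^ 2 ≤ (I₁ q + I₂ q + I₃ q) ^ 2 := pow_le_pow_left₀ (hd0 q) (hle q) 2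
    have h2 : (I₁ q + I₂ q + I₃ q) ^ 2 ≤ 3 * (I₁ q ^ 2 + I₂ q ^ 2 + I₃ q ^ 2) := by
      nlinarith [sq_nonneg (I₁ q - I₂ q), sq_nonneg (I₂ q - I₃ q), sq_nonneg (I₁ q - I₃ q)]
    calc ENNReal.ofReal (d q ^ 2) ≤ ENNReal.ofReal (3 * (I₁ q ^ 2 + I₂ q ^ 2 + I₃ q ^ 2)) :=
          ENNReal.ofReal_le_ofReal (h1.trans h2)
      _ = _ := by
          rw [ENNReal.ofReal_mul (by norm_num), ENNReal.ofReal_add (by positivity) (by positivity),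
            ENNReal.ofReal_add (by positivity) (by positivity), ENNReal.ofReal_ofNat]
  have m1 : Measurable fun q => ENNReal.ofReal (I₁ q ^ 2) := (h1m.pow_const 2).ennreal_ofReal
  have m2 : Measurable fun q => ENNReal.ofReal (I₂ q ^ 2) := (h2m.pow_const 2).ennreal_ofReal
  have m3 : Measurable fun q => ENNReal.ofReal (I₃ q ^ 2) := (h3m.pow_const 2).ennreal_ofReal
  have m123 : Measurable fun q => ENNReal.ofReal (I₁ q ^ 2) + ENNReal.ofReal (I₂ q ^ 2) + ENNReal.ofReal (I₃ q ^ 2) :=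
    (m1.add m2).add m3
  calc ∫⁻ q, ENNReal.ofReal (d q ^ 2) ∂π
      ≤ ∫⁻ q, 3 * (ENNReal.ofReal (I₁ q ^ 2) + ENNReal.ofReal (I₂ q ^ 2) + ENNReal.ofReal (I₃ q ^ 2)) ∂π := lintegral_mono hpt
    _ = 3 * (∫⁻ q, ENNReal.ofReal (I₁ q ^ 2) ∂π + ∫⁻ q, ENNReal.ofReal (I₂ q ^ 2) ∂π + ∫⁻ q, ENNReal.ofReal (I₃ q ^ 2) ∂π) := by
        rw [lintegral_const_mul _ m123, lintegral_add_right _ m3, lintegral_add_right _ m2]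
    _ ≤ 3 * (ENNReal.ofReal a + ENNReal.ofReal b + ENNReal.ofReal c) :=
        mul_le_mul' le_rfl (add_le_add (add_le_add hI₁ hI₂) hI₃)
    _ = ENNReal.ofReal (3 * (a + b + c)) := by
        rw [← ENNReal.ofReal_add ha hb, ← ENNReal.ofReal_add (by positivity) hc, ← ENNReal.ofReal_ofNat,
          ← ENNReal.ofReal_mul (by norm_num)]

/-- **Cauchy–Schwarz for the near-bond term, abstract core**: `∫⁻ G (d₀ + d₁) ≤ √K_G √(4D)` when `∫⁻ G² ≤ K_G` and
`∫⁻ d₀², ∫⁻ d₁² ≤ D`. -/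
theorem lintegral_nearBond_le_abstract {Ω : Type*} [MeasurableSpace Ω] (π : Measure Ω) {Gn d0 d1 : Ω → ℝ} {KGn D : ℝ}
    (hGm : Measurable Gn) (hd0m : Measurable d0) (hd1m : Measurable d1) (hG0 : ∀ q, 0 ≤ Gn q) (hd00 : ∀ q, 0 ≤ d0 q)
    (hd10 : ∀ q, 0 ≤ d1 q) (hKGn : 0 ≤ KGn) (hD : 0 ≤ D)
    (hGsq : ∫⁻ q, ENNReal.ofReal (Gn q) ^ 2 ∂π ≤ ENNReal.ofReal KGn)
    (hd0 : ∫⁻ q, ENNReal.ofReal (d0 q ^ 2) ∂π ≤ ENNReal.ofReal D) (hd1 : ∫⁻ q, ENNReal.ofReal (d1 q ^ 2) ∂π ≤ ENNReal.ofReal D) :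
    ∫⁻ q, ENNReal.ofReal (Gn q * (d0 q + d1 q)) ∂π ≤ ENNReal.ofReal (Real.sqrt KGn * Real.sqrt (4 * D)) := by
  have m0 : Measurable fun q => ENNReal.ofReal (d0 q ^ 2) := (hd0m.pow_const 2).ennreal_ofReal
  have m1 : Measurable fun q => ENNReal.ofReal (d1 q ^ 2) := (hd1m.pow_const 2).ennreal_ofReal
  have hsum_m : Measurable fun q => ENNReal.ofReal (d0 q + d1 q) := (hd0m.add hd1m).ennreal_ofReal
  have hdsq : ∫⁻ q, ENNReal.ofReal (d0 q + d1 q) ^ 2 ∂π ≤ ENNReal.ofReal (4 * D) := by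
    have hpt : ∀ q, ENNReal.ofReal (d0 q + d1 q) ^ 2 ≤ 2 * ENNReal.ofReal (d0 q ^ 2) + 2 * ENNReal.ofReal (d1 q ^ 2) := by
      intro q
      have h : (d0 q + d1 q) ^ 2 ≤ 2 * d0 q ^ 2 + 2 * d1 q ^ 2 := by nlinarith [sq_nonneg (d0 q - d1 q)]
      rw [← ENNReal.ofReal_pow (add_nonneg (hd00 q) (hd10 q))]
      calc ENNReal.ofReal ((d0 q + d1 q) ^ 2) ≤ ENNReal.ofReal (2 * d0 q ^ 2 + 2 * d1 q ^ 2) := ENNReal.ofReal_le_ofReal h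
        _ = _ := by
            rw [ENNReal.ofReal_add (by positivity) (by positivity), ENNReal.ofReal_mul zero_le_two,
              ENNReal.ofReal_mul zero_le_two, ENNReal.ofReal_ofNat]
    calc ∫⁻ q, ENNReal.ofReal (d0 q + d1 q) ^ 2 ∂π ≤ ∫⁻ q, (2 * ENNReal.ofReal (d0 q ^ 2) + 2 * ENNReal.ofReal (d1 q ^ 2)) ∂π :=
          lintegral_mono hpt
      _ = 2 * ∫⁻ q, ENNReal.ofReal (d0 q ^ 2) ∂π + 2 * ∫⁻ q, ENNReal.ofReal (d1 q ^ 2) ∂π := by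
          rw [lintegral_add_left (m0.const_mul 2), lintegral_const_mul 2 m0, lintegral_const_mul 2 m1]
      _ ≤ 2 * ENNReal.ofReal D + 2 * ENNReal.ofReal D := add_le_add (mul_le_mul' le_rfl hd0) (mul_le_mul' le_rfl hd1)
      _ = ENNReal.ofReal (4 * D) := by
          rw [← ENNReal.ofReal_ofNat, ← ENNReal.ofReal_mul zero_le_two, ← ENNReal.ofReal_add (by positivity) (by positivity)]
          congr 1; ring
  have hCS := lintegral_mul_le_sqrt_mul_sqrt π hGm.ennreal_ofReal.aemeasurable hsum_m.aemeasurable hKGn (by positivity)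
    hGsq hdsq
  calc ∫⁻ q, ENNReal.ofReal (Gn q * (d0 q + d1 q)) ∂π = ∫⁻ q, ENNReal.ofReal (Gn q) * ENNReal.ofReal (d0 q + d1 q) ∂π :=
        lintegral_congr fun q => ENNReal.ofReal_mul (hG0 q)
    _ ≤ _ := hCS

/-- **Pathwise bookkeeping at the contact bond** (pure real inequalities). -/
theorem nearBond_pathwise_abstract {A Δ cj E E' dq dp dq' dp' : ℝ} (hA : 0 ≤ A)
    (hΔ : Δ ≤ cj * E ^ 2 * E' ^ 2 * (dq + dp + dq' + dp')) :
    A * Δ ≤ cj * A * E ^ 2 * E' ^ 2 * ((dq + dp) + (dq' + dp')) := by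
  calc A * Δ ≤ A * (cj * E ^ 2 * E' ^ 2 * (dq + dp + dq' + dp')) := mul_le_mul_of_nonneg_left hΔ hA
    _ = cj * A * E ^ 2 * E' ^ 2 * ((dq + dp) + (dq' + dp')) := by ring

/-! ### The displacement of one site over `[0, s]` -/

variable {ω₂ lam β γ : ℝ} (hω : 0 < ω₂) (hl : 0 ≤ lam) (hβ : 0 ≤ β) (hγ : 0 ≤ γ) {T : ℝ} (hT : 0 < T)

include hω hl hβ hγ hT in
/-- **Second moment of the displacement of one site.**  With the factorial Gibbs moments (`C, A`) and the `N`-uniform drift moment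
`C_Y`: for every `N ≥ 1`, site `m` and `s ≥ 0`,
`∫⁻ (|q_m(Φ_s x) − q_m(x)| + |p_m(Φ_s x) − p_m(x)|)² d(μ_T ⊗ W) ≤ 3 (s² C A + 8γTs + s² C_Y)`. -/
theorem lintegral_siteDisplacement_sq_le {C A CY : ℝ}
    (hmom : ∀ (N : ℕ) (i : Fin N) (k : ℕ),
      Integrable (fun x : PhaseSpace N => x.1 i ^ (2 * k)) ((pinnedChain ω₂ lam β γ).gibbsMeasure N T) ∧
      ∫ x, x.1 i ^ (2 * k) ∂((pinnedChain ω₂ lam β γ).gibbsMeasure N T) ≤ C * (A * k) ^ k ∧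
      Integrable (fun x : PhaseSpace N => x.2 i ^ (2 * k)) ((pinnedChain ω₂ lam β γ).gibbsMeasure N T) ∧
      ∫ x, x.2 i ^ (2 * k) ∂((pinnedChain ω₂ lam β γ).gibbsMeasure N T) ≤ C * (A * k) ^ k)
    (hCY : ∀ (N : ℕ) (m : Fin N), Integrable (fun z => ((pinnedChain ω₂ lam β γ).drift N z).2 m ^ 2)
        ((pinnedChain ω₂ lam β γ).gibbsMeasure N T) ∧
      ∫ z, ((pinnedChain ω₂ lam β γ).drift N z).2 m ^ 2 ∂((pinnedChain ω₂ lam β γ).gibbsMeasure N T) ≤ CY)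
    {N : ℕ} (hN : 0 < N) (m : Fin N) {s : ℝ} (hs0 : 0 ≤ s) :
    ∫⁻ q, ENNReal.ofReal ((|((pinnedChain ω₂ lam β γ).solMap N T T s q.1 (pairPath q.2)).1 m - q.1.1 m| +
        |((pinnedChain ω₂ lam β γ).solMap N T T s q.1 (pairPath q.2)).2 m - q.1.2 m|) ^ 2)
        ∂(((pinnedChain ω₂ lam β γ).gibbsMeasure N T).prod wienerPair) ≤
      ENNReal.ofReal (3 * (s ^ 2 * (C * A) + 8 * γ * T * s + s ^ 2 * CY)) := by
  set P := pinnedChain ω₂ lam β γ with hP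
  set μ := P.gibbsMeasure N T with hμ
  set π : Measure (PhaseSpace N × WienerPair) := μ.prod wienerPair with hπ
  haveI hμP : IsProbabilityMeasure μ := pinnedChain_isProbabilityMeasure_gibbsMeasure hω hl hβ γ N hT
  set Φ : ℝ → PhaseSpace N × WienerPair → PhaseSpace N := fun r q => P.solMap N T T r q.1 (pairPath q.2) with hΦ
  set Ip : PhaseSpace N × WienerPair → ℝ := fun q => ∫ r in (0:ℝ)..s, |(Φ r q).2 m| with hIp
  set In : PhaseSpace N × WienerPair → ℝ := fun q => |P.pairNoise N T T (pairPath q.2) s m| with hIn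
  set IY : PhaseSpace N × WienerPair → ℝ := fun q => ∫ r in (0:ℝ)..s, |(P.drift N (Φ r q)).2 m| with hIY
  -- continuity / measurability
  have hdc : Continuous fun z : PhaseSpace N => (P.drift N z).2 m :=
    (continuous_apply m).comp (continuous_snd.comp (pinnedChain_contDiff_drift ω₂ lam β γ N (n := 0)).continuous)
  have hΦc : ∀ q, Continuous fun r => Φ r q := fun q => pinnedChain_continuous_solMap hω hl hβ hγ N T T q.1 (pairPath q.2)
  have hΦm : ∀ r, Measurable (Φ r) := fun r => pinnedChain_measurable_solMap_pairPath hω hl hβ hγ N T T r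
  have hIpm : Measurable Ip := measurable_intervalIntegral_of_continuous_of_measurable
    (fun q => ((continuous_apply m).comp (continuous_snd.comp (hΦc q))).abs)
    (fun r => ((measurable_pi_apply m).comp (measurable_snd.comp (hΦm r))).abs) s
  have hIYm : Measurable IY := measurable_intervalIntegral_of_continuous_of_measurable
    (fun q => (hdc.comp (hΦc q)).abs) (fun r => (hdc.measurable.comp (hΦm r)).abs) s
  have hInm : Measurable In :=
    ((measurable_pi_apply m).comp ((P.measurable_pairNoise N T T s).comp (measurable_pairPath.comp measurable_snd))).abs
  -- the integral equation
  have hle : ∀ q, |(Φ s q).1 m - q.1.1 m| + |(Φ s q).2 m - q.1.2 m| ≤ Ip q + In q + IY q := by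
    intro q
    have hηc := P.continuous_pairNoise N T T (pairPath q.2)
    have h1 : (Φ s q).1 m = q.1.1 m + ∫ r in (0:ℝ)..s, (Φ r q).2 m :=
      pinnedChain_chainFlow_fst_apply hω hl hβ hγ N q.1 hηc m hs0
    have h2 : (Φ s q).2 m = q.1.2 m + P.pairNoise N T T (pairPath q.2) s m + ∫ r in (0:ℝ)..s, (P.drift N (Φ r q)).2 m :=
      pinnedChain_chainFlow_snd_apply hω hl hβ hγ N q.1 hηc m hs0
    have hq : |(Φ s q).1 m - q.1.1 m| ≤ Ip q := by
      rw [h1, add_sub_cancel_left]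
      exact intervalIntegral.abs_integral_le_integral_abs hs0
    have hp : |(Φ s q).2 m - q.1.2 m| ≤ In q + IY q := by
      rw [h2, show q.1.2 m + P.pairNoise N T T (pairPath q.2) s m + (∫ r in (0:ℝ)..s, (P.drift N (Φ r q)).2 m) - q.1.2 m =
        P.pairNoise N T T (pairPath q.2) s m + ∫ r in (0:ℝ)..s, (P.drift N (Φ r q)).2 m by ring]
      exact (abs_add_le _ _).trans (add_le_add le_rfl (intervalIntegral.abs_integral_le_integral_abs hs0))
    linarith
  -- the three second moments
  obtain ⟨-, -, ip2, hp2⟩ := hmom N m 1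
  have hgM1 : Integrable (fun y : PhaseSpace N => |y.2 m| ^ 2) μ ∧ ∫ y, |y.2 m| ^ 2 ∂μ ≤ C * A := by
    simp only [sq_abs]
    exact ⟨by simpa using ip2, by simpa using hp2⟩
  have hIp : ∫⁻ q, ENNReal.ofReal (Ip q ^ 2) ∂π ≤ ENNReal.ofReal (s ^ 2 * (C * A)) :=
    lintegral_sq_timeIntegral_comp_solMap_le hω hl hβ hγ N hN hT (g := fun z : PhaseSpace N => |z.2 m|) (by fun_prop)
      (fun z => abs_nonneg _) hgM1 hs0
  have hgM2 : Integrable (fun y : PhaseSpace N => |(P.drift N y).2 m| ^ 2) μ ∧ ∫ y, |(P.drift N y).2 m| ^ 2 ∂μ ≤ CY := by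
    simp only [sq_abs]
    exact hCY N m
  have hIY : ∫⁻ q, ENNReal.ofReal (IY q ^ 2) ∂π ≤ ENNReal.ofReal (s ^ 2 * CY) :=
    lintegral_sq_timeIntegral_comp_solMap_le hω hl hβ hγ N hN hT (g := fun z : PhaseSpace N => |(P.drift N z).2 m|) hdc.abs
      (fun z => abs_nonneg _) hgM2 hs0
  have hIn : ∫⁻ q, ENNReal.ofReal (In q ^ 2) ∂π ≤ ENNReal.ofReal (8 * γ * T * s) := by
    have h := lintegral_pairNoise_sq_le (ω₂ := ω₂) (lam := lam) (β := β) hγ N hT.le μ m hs0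
    simpa only [hIn, sq_abs] using h
  have hCA : 0 ≤ C * A := le_trans (integral_nonneg fun y => sq_nonneg _) hgM1.2
  have hCY0 : 0 ≤ CY := le_trans (integral_nonneg fun y => sq_nonneg _) hgM2.2
  have h := lintegral_displacement_sq_le_abstract π hIpm hInm hIYm (fun q => by positivity) (by positivity) (by positivity)
    (by positivity) hle hIp hIn hIY
  calc ∫⁻ q, ENNReal.ofReal ((|(Φ s q).1 m - q.1.1 m| + |(Φ s q).2 m - q.1.2 m|) ^ 2) ∂π
      ≤ ENNReal.ofReal (3 * (s ^ 2 * (C * A) + 8 * γ * T * s + s ^ 2 * CY)) := h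

/-! ### The contact bond -/

include hω hl hβ hγ hT in
/-- **Time continuity of the contact-bond term.**  For `N ≥ 2` and `s ∈ [0, 1]`:
`∫⁻ |a₀(x)| |j_0(Φ_s x) − j_0(x)| d(μ_T ⊗ W) ≤ √(2c_j²c_a²K) · √(12 (s²CA + 8γTs + s²C_Y))`. -/
theorem lintegral_contactPower_mul_nearDiff_le {K : ℝ}
    (hK : ∀ (N : ℕ) (k l : Fin N) (a : ℕ), a ≤ 16 →
      Integrable (fun z : PhaseSpace N => (1 + z.1 k ^ 2 + z.1 l ^ 2 + z.2 k ^ 2 + z.2 l ^ 2) ^ a) ((pinnedChain ω₂ lam β γ).gibbsMeasure N T) ∧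
      ∫ z, (1 + z.1 k ^ 2 + z.1 l ^ 2 + z.2 k ^ 2 + z.2 l ^ 2) ^ a ∂((pinnedChain ω₂ lam β γ).gibbsMeasure N T) ≤ K)
    {C A CY : ℝ}
    (hmom : ∀ (N : ℕ) (i : Fin N) (k : ℕ),
      Integrable (fun x : PhaseSpace N => x.1 i ^ (2 * k)) ((pinnedChain ω₂ lam β γ).gibbsMeasure N T) ∧
      ∫ x, x.1 i ^ (2 * k) ∂((pinnedChain ω₂ lam β γ).gibbsMeasure N T) ≤ C * (A * k) ^ k ∧
      Integrable (fun x : PhaseSpace N => x.2 i ^ (2 * k)) ((pinnedChain ω₂ lam β γ).gibbsMeasure N T) ∧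
      ∫ x, x.2 i ^ (2 * k) ∂((pinnedChain ω₂ lam β γ).gibbsMeasure N T) ≤ C * (A * k) ^ k)
    (hCY : ∀ (N : ℕ) (m : Fin N), Integrable (fun z => ((pinnedChain ω₂ lam β γ).drift N z).2 m ^ 2)
        ((pinnedChain ω₂ lam β γ).gibbsMeasure N T) ∧
      ∫ z, ((pinnedChain ω₂ lam β γ).drift N z).2 m ^ 2 ∂((pinnedChain ω₂ lam β γ).gibbsMeasure N T) ≤ CY)
    {N : ℕ} (hN : 0 < N) (hN2 : 2 ≤ N) {s : ℝ} (hs0 : 0 ≤ s) :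
    ∫⁻ q, ENNReal.ofReal (|q.1.2 ⟨0, hN⟩ * partialQ ⟨0, hN⟩ ((pinnedChain ω₂ lam β γ).hamiltonian N) q.1| *
        |(pinnedChain ω₂ lam β γ).bondCurrent N ⟨0, hN⟩ ((pinnedChain ω₂ lam β γ).solMap N T T s q.1 (pairPath q.2)) -
          (pinnedChain ω₂ lam β γ).bondCurrent N ⟨0, hN⟩ q.1|)
        ∂(((pinnedChain ω₂ lam β γ).gibbsMeasure N T).prod wienerPair) ≤
      ENNReal.ofReal (Real.sqrt (2 * (7 + 15 * β) ^ 2 * (ω₂ + 2 * lam + 2 + 5 * β) ^ 2 * K) *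
        Real.sqrt (4 * (3 * (s ^ 2 * (C * A) + 8 * γ * T * s + s ^ 2 * CY)))) := by
  set P := pinnedChain ω₂ lam β γ with hP
  set μ := P.gibbsMeasure N T with hμ
  set π : Measure (PhaseSpace N × WienerPair) := μ.prod wienerPair with hπ
  haveI hμP : IsProbabilityMeasure μ := pinnedChain_isProbabilityMeasure_gibbsMeasure hω hl hβ γ N hT
  set i0 : Fin N := ⟨0, hN⟩ with hi0
  have hk01 : i0.val + 1 < N := by simp [hi0]; omega
  set i1 : Fin N := ⟨i0.val + 1, hk01⟩ with hi1
  set cj : ℝ := 7 + 15 * β with hcj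
  set ca : ℝ := ω₂ + 2 * lam + 2 + 5 * β with hca
  have hcj0 : 0 ≤ cj := by positivity
  have hca0 : 0 ≤ ca := by positivity
  set Φ : ℝ → PhaseSpace N × WienerPair → PhaseSpace N := fun r q => P.solMap N T T r q.1 (pairPath q.2) with hΦ
  set E : PhaseSpace N → ℝ := fun z => 1 + z.1 i0 ^ 2 + z.1 i1 ^ 2 + z.2 i0 ^ 2 + z.2 i1 ^ 2 with hE
  set Gn : PhaseSpace N × WienerPair → ℝ := fun q =>
    cj * |q.1.2 i0 * partialQ i0 (P.hamiltonian N) q.1| * E q.1 ^ 2 * E (Φ s q) ^ 2 with hGn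
  set d : Fin N → PhaseSpace N × WienerPair → ℝ := fun m q => |(Φ s q).1 m - q.1.1 m| + |(Φ s q).2 m - q.1.2 m| with hd
  have hK0 : 0 ≤ K := by
    obtain ⟨-, hle⟩ := hK N i0 i1 0 (by norm_num)
    simp at hle
    linarith
  have hE0 : ∀ z, 0 ≤ E z := fun z => by positivity
  have hG0 : ∀ q, 0 ≤ Gn q := fun q => by positivity
  have hd0 : ∀ m q, 0 ≤ d m q := fun m q => by positivity
  -- pathwise
  have hF : ∀ q, |q.1.2 i0 * partialQ i0 (P.hamiltonian N) q.1| * |P.bondCurrent N i0 (Φ s q) - P.bondCurrent N i0 q.1| ≤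
      Gn q * (d i0 q + d i1 q) := by
    intro q
    have hj := abs_bondCurrent_sub_le_scalar (ω₂ := ω₂) (lam := lam) (γ := γ) hβ i0 hk01 q.1 (Φ s q)
    exact nearBond_pathwise_abstract (abs_nonneg _) hj
  -- measurability
  have hΦm : ∀ r, Measurable (Φ r) := fun r => pinnedChain_measurable_solMap_pairPath hω hl hβ hγ N T T r
  have hEc : Continuous E := by simp only [hE]; fun_prop
  have hH1 : ContDiff ℝ 1 (P.hamiltonian N) := pinnedChain_contDiff_hamiltonian ω₂ lam β γ N
  have hac : Continuous fun x : PhaseSpace N => x.2 i0 * partialQ i0 (P.hamiltonian N) x :=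
    (by fun_prop : Continuous fun z : PhaseSpace N => z.2 i0).mul (P.continuous_partialQ_hamiltonian hH1 _)
  have hGm : Measurable Gn := by
    have m1 : Measurable fun q : PhaseSpace N × WienerPair => |q.1.2 i0 * partialQ i0 (P.hamiltonian N) q.1| :=
      (hac.measurable.comp measurable_fst).abs
    have m3 : Measurable fun q : PhaseSpace N × WienerPair => E q.1 ^ 2 := (hEc.measurable.comp measurable_fst).pow_const 2
    have m4 : Measurable fun q : PhaseSpace N × WienerPair => E (Φ s q) ^ 2 := (hEc.measurable.comp (hΦm s)).pow_const 2
    exact ((m1.const_mul cj).mul m3).mul m4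
  have hdm : ∀ m, Measurable (d m) := by
    intro m
    have h1 : Measurable fun q : PhaseSpace N × WienerPair => (Φ s q).1 m - q.1.1 m :=
      ((measurable_pi_apply m).comp (measurable_fst.comp (hΦm s))).sub
        ((measurable_pi_apply m).comp (measurable_fst.comp measurable_fst))
    have h2 : Measurable fun q : PhaseSpace N × WienerPair => (Φ s q).2 m - q.1.2 m :=
      ((measurable_pi_apply m).comp (measurable_snd.comp (hΦm s))).sub
        ((measurable_pi_apply m).comp (measurable_snd.comp measurable_fst))
    exact h1.abs.add h2.abs
  -- the prefactor moment
  obtain ⟨h0, hs, -⟩ := lintegral_bondScalar_pow_le hω hl hβ hγ hT hK hN i0 i1 i0 s (a := 14) (by norm_num)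
  have hGsq : ∫⁻ q, ENNReal.ofReal (Gn q) ^ 2 ∂π ≤ ENNReal.ofReal (2 * cj ^ 2 * ca ^ 2 * K) :=
    lintegral_nearPrefactor_sq_le_abstract π hcj0 hca0 hK0
      (a := fun q : PhaseSpace N × WienerPair => q.1.2 i0 * partialQ i0 (P.hamiltonian N) q.1)
      (E0 := fun q : PhaseSpace N × WienerPair => E q.1) (Es := fun q : PhaseSpace N × WienerPair => E (Φ s q))
      (hEc.measurable.comp measurable_fst) (hEc.measurable.comp (hΦm s))
      (fun q => (bondScalar_bounds _ _ _ _).1) (fun q => hE0 _)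
      (fun q => abs_contactPower_le_scalar (γ := γ) hω.le hl hβ hN hN2 q.1) h0 hs
  -- the displacements
  have hD : ∀ m : Fin N, ∫⁻ q, ENNReal.ofReal (d m q ^ 2) ∂π ≤ ENNReal.ofReal (3 * (s ^ 2 * (C * A) + 8 * γ * T * s + s ^ 2 * CY)) :=
    fun m => lintegral_siteDisplacement_sq_le hω hl hβ hγ hT hmom hCY hN m hs0
  have hCA : 0 ≤ C * A := by
    obtain ⟨-, -, -, hp2⟩ := hmom N i0 1
    have : 0 ≤ ∫ x, x.2 i0 ^ (2 * 1) ∂μ := integral_nonneg fun x => pow_nonneg' (x.2 i0) 1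
    have h' : ∫ x, x.2 i0 ^ (2 * 1) ∂μ ≤ C * A := by simpa using hp2
    linarith
  have hCY0 : 0 ≤ CY := by
    obtain ⟨-, h2⟩ := hCY N i0
    exact le_trans (integral_nonneg fun y => sq_nonneg _) h2
  have key := lintegral_nearBond_le_abstract π hGm (hdm i0) (hdm i1) hG0 (hd0 i0) (hd0 i1) (by positivity) (by positivity)
    hGsq (hD i0) (hD i1)
  calc ∫⁻ q, ENNReal.ofReal (|q.1.2 i0 * partialQ i0 (P.hamiltonian N) q.1| *
        |P.bondCurrent N i0 (Φ s q) - P.bondCurrent N i0 q.1|) ∂π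
      ≤ ∫⁻ q, ENNReal.ofReal (Gn q * (d i0 q + d i1 q)) ∂π := lintegral_mono fun q => ENNReal.ofReal_le_ofReal (hF q)
    _ ≤ _ := key

/-- **Registered helper `helper_kdContactBondContinuity` (stub S, line `kick-dipole-no-collapse`): TIME CONTINUITY OF THE
CONTACT-BOND TERM, UNIFORMLY IN `N`.**  For the pinned chain (`ω₂ > 0`, `lam, β, γ ≥ 0`) and `T > 0` there is `B ≥ 0` such that for
every `N ≥ 2` and `s ∈ [0, 1]`:  `∫⁻ |a₀(x)| · |j_0(Φ_s(x,ω)) − j_0(x)| d(μ_T ⊗ W) ≤ B √s`. -/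
theorem helper_kdContactBondContinuity : ∀ ω₂ lam β γ : ℝ, 0 < ω₂ → 0 ≤ lam → 0 ≤ β → 0 ≤ γ → ∀ T : ℝ, 0 < T → ∃ B : ℝ, 0 ≤ B ∧ ∀ (N : ℕ) (hN : 0 < N), 2 ≤ N → ∀ s : ℝ, 0 ≤ s → s ≤ 1 → ∫⁻ q, ENNReal.ofReal (|q.1.2 ⟨0, hN⟩ * partialQ ⟨0, hN⟩ ((pinnedChain ω₂ lam β γ).hamiltonian N) q.1| * |(pinnedChain ω₂ lam β γ).bondCurrent N ⟨0, hN⟩ ((pinnedChain ω₂ lam β γ).solMap N T T s q.1 (pairPath q.2)) - (pinnedChain ω₂ lam β γ).bondCurrent N ⟨0, hN⟩ q.1|) ∂(((pinnedChain ω₂ lam β γ).gibbsMeasure N T).prod wienerPair) ≤ ENNReal.ofReal (B * Real.sqrt s) := by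
  intro ω₂ lam β γ hω hl hβ hγ T hT
  obtain ⟨K, -, hK⟩ := exists_bondScalar_moment_bound hω hl hβ hT
  obtain ⟨C, A, hC1, hA0, hmom⟩ := helper_kdGibbsFactorialMoments ω₂ lam β γ hω hl hβ T hT
  obtain ⟨CY, hCY0, hCY⟩ := helper_kdDriftSecondMoment ω₂ lam β γ hω hl hβ hγ T hT
  have hC0 : 0 ≤ C := zero_le_one.trans hC1
  set B : ℝ := Real.sqrt (2 * (7 + 15 * β) ^ 2 * (ω₂ + 2 * lam + 2 + 5 * β) ^ 2 * K) *
    Real.sqrt (12 * (C * A + 8 * γ * T + CY)) with hB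
  refine ⟨B, by positivity, fun N hN hN2 s hs0 hs1 => ?_⟩
  have h := lintegral_contactPower_mul_nearDiff_le hω hl hβ hγ hT hK hmom hCY hN hN2 hs0
  refine h.trans (ENNReal.ofReal_le_ofReal ?_)
  have hs2 : s ^ 2 ≤ s := by nlinarith
  have hCA : 0 ≤ C * A := mul_nonneg hC0 hA0.le
  have hin : 4 * (3 * (s ^ 2 * (C * A) + 8 * γ * T * s + s ^ 2 * CY)) ≤ 12 * (C * A + 8 * γ * T + CY) * s := by
    nlinarith [mul_le_mul_of_nonneg_right hs2 hCA, mul_le_mul_of_nonneg_right hs2 hCY0]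
  calc Real.sqrt (2 * (7 + 15 * β) ^ 2 * (ω₂ + 2 * lam + 2 + 5 * β) ^ 2 * K) *
        Real.sqrt (4 * (3 * (s ^ 2 * (C * A) + 8 * γ * T * s + s ^ 2 * CY)))
      ≤ Real.sqrt (2 * (7 + 15 * β) ^ 2 * (ω₂ + 2 * lam + 2 + 5 * β) ^ 2 * K) *
          Real.sqrt (12 * (C * A + 8 * γ * T + CY) * s) :=
        mul_le_mul_of_nonneg_left (Real.sqrt_le_sqrt hin) (Real.sqrt_nonneg _)
    _ = B * Real.sqrt s := by rw [hB, Real.sqrt_mul (by positivity) s]; ring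

end Summit.AtomisticToContinuum.FouriersLaw.Cruxes.ConductanceLowerBound.KickDipoleNoCollapse

end
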